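import Summits.QuantumAdvantage.QuantumAdvantage.Theorems.SosSandwichAntipodalNotPseudoBounded

/-!
# Route `SosSandwich`: the antipodal non-inclusion with few variables, `N = T + 2`

`SosSandwichAntipodalNotPseudoBounded` refutes «`[0,1]`-bounded ∧ antipodal ∧ `deg ≤ 2T - 1` ⟹
pseudo-bounded of order `T`» for every `T ≥ 2` with the self-dual selector `y_k ? AND_k : OR_k` on
`k + 1 = 2T` bits (`k` odd). Here the parity bookkeeping is dropped: for EVERY `k ≥ 1` the selector on
`k + 1` bits, written with products (`OR_k = 1 - Π (1 - y_i)`, `AND_k = Π y_i`), has total degree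
`≤ k + 1`, is `{0,1}`-valued and antipodal, and is not pseudo-bounded of order `k - 1` (same face
argument: on `b = 0`, `1 - f` is the indicator of the origin of a `k`-dimensional face, and
`evalBool_eq_zero_of_vanish_on_face` applies to every `r_j` of degree `≤ k - 1`). Choosing `k = T + 1`
gives, for every `T ≥ 3`, a witness on only `N = T + 2` variables of total degree `≤ T + 2 ≤ 2T - 1`
outside `K_T`; together with the `N = 4` cubic of the base file (`T = 2`) this is
`exists_antipodal_not_pseudoBounded_smallN`. Example `T = 3`, `N = 5`: `y₄ ? AND₄ : OR₄` (degree `5`) —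
the gate-aa-sos census cell where the level-3 pseudo-expectation bound first exceeds `1`
(HOME/CENSUS.md, antipodal section; numerically no counterexample exists on `T + 1` variables for `T = 2, 3`).
-/

set_option linter.dupNamespace false -- D-0017: single-problem summit ⇒ `QuantumAdvantage.QuantumAdvantage` by design

namespace Summit.QuantumAdvantage.QuantumAdvantage.Theorems.SosSandwich

open Finset MvPolynomial Literature.Computability.QuantumComplexity
  Literature.Computability.Complexity.LowDegree Literature.Probability.RandomGraphs.LowDegree

/-- **Selector witness, any parity.** For every `k ≥ 1` there is a polynomial on `k + 1` Boolean variables of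
total degree `≤ k + 1`, `{0,1}`-valued and antipodal (`f(¬x) = 1 - f(x)`) on the cube, that is NOT
pseudo-bounded of order `k - 1`: `f(y, b) = if b then AND_k(y) else OR_k(y)`
`= OR_k - y_b · (OR_k - AND_k)` with `OR_k = 1 - Π_i (1 - y_i)`, `AND_k = Π_i y_i`. On the face `b = 0`,
`1 - f` is the indicator of the origin; every `r_j` of a degree-`≤ k - 1` certificate `1 - f = Σ r_j²`
vanishes on the rest of that face, hence (`evalBool_eq_zero_of_vanish_on_face`) at the origin, where
`1 - f = 1`. [folklore] -/
theorem exists_antipodal_selector_not_pseudoBounded (k : ℕ) (hk : 1 ≤ k) :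
    ∃ p : MvPolynomial (Fin (k + 1)) ℝ, p.totalDegree ≤ k + 1 ∧
      (∀ x : Fin (k + 1) → Bool, MvPolynomial.eval (fun j => if x j then (1 : ℝ) else 0) p = 0 ∨
        MvPolynomial.eval (fun j => if x j then (1 : ℝ) else 0) p = 1) ∧
      (∀ x : Fin (k + 1) → Bool, MvPolynomial.eval (fun j => if (!x j) then (1 : ℝ) else 0) p =
        1 - MvPolynomial.eval (fun j => if x j then (1 : ℝ) else 0) p) ∧
      ¬ PseudoBounded (k - 1) p := by
  classical
  set NORp : MvPolynomial (Fin (k + 1)) ℝ := ∏ i : Fin k, (1 - X (Fin.castSucc i)) with hNORp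
  set ANDp : MvPolynomial (Fin (k + 1)) ℝ := ∏ i : Fin k, X (Fin.castSucc i) with hANDp
  set f : MvPolynomial (Fin (k + 1)) ℝ := (1 - NORp) - X (Fin.last k) * ((1 - NORp) - ANDp) with hf
  -- the two predicates "all of `y` false / true"
  let F0 : (Fin (k + 1) → Bool) → Prop := fun x => ∀ i : Fin k, x (Fin.castSucc i) = false
  let F1 : (Fin (k + 1) → Bool) → Prop := fun x => ∀ i : Fin k, x (Fin.castSucc i) = true
  have hevNOR : ∀ x : Fin (k + 1) → Bool,
      MvPolynomial.eval (fun j => if x j then (1 : ℝ) else 0) NORp = if F0 x then 1 else 0 := by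
    intro x
    rw [hNORp, map_prod]
    have : ∀ i : Fin k, MvPolynomial.eval (fun j => if x j then (1 : ℝ) else 0) (1 - X (Fin.castSucc i)) =
        if x (Fin.castSucc i) = false then 1 else 0 := by
      intro i; rw [map_sub, map_one, MvPolynomial.eval_X]; cases x (Fin.castSucc i) <;> simp
    simp_rw [this]
    rw [Finset.prod_boole]
    by_cases h : F0 x
    · rw [if_pos h, if_pos (fun i _ => h i)]
    · rw [if_neg h, if_neg (fun h' => h (fun i => h' i (Finset.mem_univ i)))]
  have hevAND : ∀ x : Fin (k + 1) → Bool,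
      MvPolynomial.eval (fun j => if x j then (1 : ℝ) else 0) ANDp = if F1 x then 1 else 0 := by
    intro x
    rw [hANDp, map_prod]; simp only [MvPolynomial.eval_X]; rw [Finset.prod_boole]
    by_cases h : F1 x
    · rw [if_pos h, if_pos (fun i _ => h i)]
    · rw [if_neg h, if_neg (fun h' => h (fun i => h' i (Finset.mem_univ i)))]
  have hev : ∀ x : Fin (k + 1) → Bool, MvPolynomial.eval (fun j => if x j then (1 : ℝ) else 0) f =
      (1 - (if F0 x then 1 else 0)) - (if x (Fin.last k) then (1 : ℝ) else 0) *
        ((1 - (if F0 x then 1 else 0)) - (if F1 x then 1 else 0)) := by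
    intro x; rw [hf]; simp only [map_sub, map_mul, map_one, MvPolynomial.eval_X]; rw [hevNOR, hevAND]
  -- `F0` and `F1` are incompatible (`k ≥ 1`), and complementation swaps them
  have h01 : ∀ x, F0 x → ¬ F1 x := fun x h0 h1 => by
    have a := h0 ⟨0, by omega⟩; have b := h1 ⟨0, by omega⟩; rw [a] at b; exact Bool.false_ne_true b
  have hc0 : ∀ x : Fin (k + 1) → Bool, F0 (fun j => !x j) ↔ F1 x := fun x => by
    simp only [F0, F1, Bool.not_eq_false']
  have hc1 : ∀ x : Fin (k + 1) → Bool, F1 (fun j => !x j) ↔ F0 x := fun x => by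
    simp only [F0, F1, Bool.not_eq_true']
  -- Boolean-valued
  have hbool : ∀ x : Fin (k + 1) → Bool, MvPolynomial.eval (fun j => if x j then (1 : ℝ) else 0) f = 0 ∨
      MvPolynomial.eval (fun j => if x j then (1 : ℝ) else 0) f = 1 := by
    intro x; rw [hev]
    by_cases h0 : F0 x
    · rw [if_pos h0, if_neg (h01 x h0)]; cases x (Fin.last k) <;> simp
    · by_cases h1 : F1 x
      · rw [if_neg h0, if_pos h1]; cases x (Fin.last k) <;> simp
      · rw [if_neg h0, if_neg h1]; cases x (Fin.last k) <;> simp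
  refine ⟨f, ?_, hbool, ?_, ?_⟩
  · -- total degree ≤ k + 1
    have hX : ∀ i : Fin k, (X (Fin.castSucc i) : MvPolynomial (Fin (k + 1)) ℝ).totalDegree ≤ 1 :=
      fun i => (totalDegree_X (R := ℝ) (Fin.castSucc i)).le
    have hNOR : NORp.totalDegree ≤ k := by
      rw [hNORp]
      refine (totalDegree_finsetProd _ _).trans ?_
      have : ∑ i : Fin k, ((1 : MvPolynomial (Fin (k + 1)) ℝ) - X (Fin.castSucc i)).totalDegree ≤
          ∑ _i : Fin k, 1 :=
        Finset.sum_le_sum fun i _ =>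
          (totalDegree_sub _ _).trans (max_le (by rw [totalDegree_one]; omega) (hX i))
      exact this.trans (by simp)
    have hAND : ANDp.totalDegree ≤ k := by
      rw [hANDp]
      refine (totalDegree_finsetProd _ _).trans ?_
      exact (Finset.sum_le_sum fun i _ => hX i).trans (by simp)
    have hOR : ((1 : MvPolynomial (Fin (k + 1)) ℝ) - NORp).totalDegree ≤ k :=
      (totalDegree_sub _ _).trans (max_le (by rw [totalDegree_one]; omega) hNOR)
    have hD : ((1 : MvPolynomial (Fin (k + 1)) ℝ) - NORp - ANDp).totalDegree ≤ k :=
      (totalDegree_sub _ _).trans (max_le hOR hAND)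
    rw [hf]
    exact (totalDegree_sub _ _).trans
      (max_le (hOR.trans (Nat.le_succ k)) ((totalDegree_mul _ _).trans (by rw [totalDegree_X]; omega)))
  · -- antipodal
    intro x
    rw [hev (fun j => !x j), hev x]
    have e0 := hc0 x; have e1 := hc1 x
    by_cases h0 : F0 x
    · have h1 : ¬ F1 x := h01 x h0
      rw [if_pos h0, if_neg h1, if_neg (fun h => h1 (e0.mp h)), if_pos (e1.mpr h0)]
      cases x (Fin.last k) <;> simp
    · by_cases h1 : F1 x
      · rw [if_neg h0, if_pos h1, if_pos (e0.mpr h1), if_neg (fun h => h0 (e1.mp h))]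
        cases x (Fin.last k) <;> simp
      · rw [if_neg h0, if_neg h1, if_neg (fun h => h1 (e0.mp h)), if_neg (fun h => h0 (e1.mp h))]
        cases x (Fin.last k) <;> simp
  · -- not pseudo-bounded of order k - 1
    rintro ⟨m, q, r, hdeg, hval⟩
    have hface : ∀ x : Fin (k + 1) → Bool, x (Fin.last k) = false → x ≠ (fun _ => false) →
        MvPolynomial.eval (fun j => if x j then (1 : ℝ) else 0) f = 1 := by
      intro x hl hx
      have h0 : ¬ F0 x := by
        intro h0
        apply hx
        funext j
        cases Fin.eq_castSucc_or_eq_last j with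
        | inl h => obtain ⟨i, rfl⟩ := h; exact h0 i
        | inr h => rw [h]; exact hl
      rw [hev, hl, if_neg h0]; simp
    have horigin : MvPolynomial.eval (fun j => if (fun _ : Fin (k + 1) => false) j then (1 : ℝ) else 0) f = 0 := by
      have h0 : F0 (fun _ => false) := fun _ => rfl
      rw [hev, if_pos h0]; simp
    have hvan : ∀ j, ∀ x : Fin (k + 1) → Bool, x (Fin.last k) = false → x ≠ (fun _ => false) →
        evalBool (r j) x = 0 := by
      intro j x hl hx
      have h1 := (hval x).2
      rw [hface x hl hx, sub_self] at h1
      exact (pow_eq_zero_iff two_ne_zero).mp ((Finset.sum_eq_zero_iff_of_nonneg (fun j _ =>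
        sq_nonneg _)).mp h1.symm j (Finset.mem_univ j))
    have hzero : ∀ j, evalBool (r j) (fun _ => false) = 0 := fun j =>
      evalBool_eq_zero_of_vanish_on_face (Fin.last k) (r j) (by have := (hdeg j).2; omega)
        (fun _ => false) rfl (hvan j)
    have h0 := (hval (fun _ => false)).2; rw [horigin] at h0
    have hsum0 : ∑ j, MvPolynomial.eval (fun l => if (fun _ : Fin (k + 1) => false) l then (1 : ℝ) else 0) (r j) ^ 2
        = 0 :=
      Finset.sum_eq_zero fun j _ => by
        have := hzero j; unfold evalBool at this; rw [this]; ring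
    linarith

/-- **`N = T + 2` variables suffice (all `T ≥ 2`).** Some `{0,1}`-valued antipodal polynomial of total degree
`≤ 2T - 1` on `T + 2` Boolean variables is not pseudo-bounded of order `T`: for `T = 2` the cubic
`y₃ ? AND₃ : OR₃` of `exists_antipodal_cubic_not_pseudoBounded_two`, for `T ≥ 3` the selector
`y_{T+1} ? AND_{T+1} : OR_{T+1}` (degree `≤ T + 2 ≤ 2T - 1`). Compare `exists_antipodal_not_pseudoBounded_order`
(`N = 2T`). [folklore] -/
theorem exists_antipodal_not_pseudoBounded_smallN (T : ℕ) (hT : 2 ≤ T) :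
    ∃ p : MvPolynomial (Fin (T + 2)) ℝ, p.totalDegree ≤ 2 * T - 1 ∧
      (∀ x : Fin (T + 2) → Bool, MvPolynomial.eval (fun j => if x j then (1 : ℝ) else 0) p = 0 ∨
        MvPolynomial.eval (fun j => if x j then (1 : ℝ) else 0) p = 1) ∧
      (∀ x : Fin (T + 2) → Bool, MvPolynomial.eval (fun j => if (!x j) then (1 : ℝ) else 0) p =
        1 - MvPolynomial.eval (fun j => if x j then (1 : ℝ) else 0) p) ∧
      ¬ PseudoBounded T p := by
  rcases Nat.lt_or_ge 2 T with hT3 | hT2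
  · -- `T ≥ 3`: the any-parity selector with `k = T + 1`, degree `≤ T + 2 ≤ 2T - 1`
    obtain ⟨p, hdeg, hbool, hanti, hnot⟩ := exists_antipodal_selector_not_pseudoBounded (T + 1) (by omega)
    exact ⟨p, hdeg.trans (by omega), hbool, hanti, fun h => hnot (h.mono (by omega))⟩
  · -- `T = 2`: the cubic on four variables
    obtain rfl : T = 2 := le_antisymm hT2 hT
    obtain ⟨p, hdeg, hbool, -, hanti, hnot⟩ := exists_antipodal_cubic_not_pseudoBounded_two
    exact ⟨p, hdeg, hbool, hanti, hnot⟩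

end Summit.QuantumAdvantage.QuantumAdvantage.Theorems.SosSandwich
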